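import Summits.ValiantsHypothesis.ValiantsHypothesis.Theorems.MonotoneRestorationOrbitCompressionQPExtraction
import Literature.Computability.AlgebraicComplexity.SymmetricOrbitCircuitEval
import HarnessLib

/-!
# Route MonotoneRestoration — aside `OrbitCompressionQP` (stmt-ValiantsHypothesis-18332): QUASI-POLYNOMIAL
# ORBITS = NARROW ONE-SORTED EXPRESSIONS (the one-sorted Dawar–Pago–Seppelt characterisation, packaged)

* `qpOrbitFamily_iff_diNarrow` — **a family `f` has square-symmetric circuits of quasi-polynomial ORBIT
  size if and only if every `f n` is diagonally invariant and, from some `n₀` on, `f n` is the closed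
  polynomial of a ONE-SORTED labelled pattern expression (`Literature.…DiPatternExpr`) with
  `n^{k_n} ≤ 2^{(log₂ n + c)^c}` labels — of ANY length.**  (`⇒`: support theorem in orbit form, reduced
  term circuits, Dawar–Wilsenach's Alt→Sym induction, value-currency extraction —
  `OrbitSupport.diNarrow_of_qpOrbitFamily`; `⇐`: supported value derivations and value-orbit
  symmetrisation — `NarrowToOrbit.exists_symmetric_orbit_le_of_diClose`, small `n` through the orbit
  circuit.)  Dawar–Pago–Seppelt 2025 prove the BIPARTITE analogue (`Sym_n × Sym_m`-symmetric circuits,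
  Thm 1.1, polynomial scale) and leave the `Sym_n` case open (p. 17 Remark, p. 45); this is its
  expression-currency form at the quasi-polynomial scale.  VH-free, `VP`-free; the aside itself (orbit ⇒
  SIZE for `VP` families) is untouched.

Helper file (`--supports stmt-ValiantsHypothesis-18332`); def-free; nothing here is a named fact.
-/

noncomputable section

open scoped Classical

-- `Summit.ValiantsHypothesis.ValiantsHypothesis.…` is the tree's single-conjunct layout (Sub = Summit).
set_option linter.dupNamespace false

namespace Summit.ValiantsHypothesis.ValiantsHypothesis.Theorems

namespace OrbitSupport

open Literature.Computability.AlgebraicComplexity MvPolynomial DiPatternExpr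

/-- **QUASI-POLYNOMIAL ORBITS = NARROW ONE-SORTED EXPRESSIONS.** [cite: DawarPagoSeppelt2025, Theorem 1.1 and §7 (p. 45); DawarWilsenach2025, §6] -/
theorem qpOrbitFamily_iff_diNarrow (f : (n : ℕ) → MvPolynomial (Fin n × Fin n) ℂ) :
    (∃ c : ℕ, ∀ n : ℕ, ∃ (G : Type) (_ : Fintype G)
        (C : LabelledArithCircuit ℂ (Fin n × Fin n) Unit G),
      C.IsSymmetric (Equiv.Perm (Fin n)) ∧ C.eval (C.output ()) = f n ∧
      C.orbitSize (Equiv.Perm (Fin n)) ≤ 2 ^ ((Nat.log 2 n + c) ^ c)) ↔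
    ((∀ (n : ℕ) (σ : Equiv.Perm (Fin n)), ren σ (f n) = f n) ∧
      ∃ c n₀ : ℕ, ∀ n : ℕ, n₀ ≤ n → ∃ (k : ℕ) (e : DiPatternExpr ℂ k),
        n ^ k ≤ 2 ^ ((Nat.log 2 n + c) ^ c) ∧ e.close n = f n) := by
  constructor
  · intro horb
    refine ⟨fun n σ => ?_, diNarrow_of_qpOrbitFamily f horb⟩
    obtain ⟨c, hc⟩ := horb
    obtain ⟨G, inst, C, hC, hev, -⟩ := hc n
    rw [← hev]
    exact hC.rename_eval_output_unit σ
  · rintro ⟨hinv, c, n₀, hc⟩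
    -- a symmetric circuit at every `n` (the orbit circuit), to absorb `n < n₀` in the constant
    have hsmall : ∀ n : ℕ, ∃ M : ℕ, ∃ (G : Type) (_ : Fintype G)
        (C : LabelledArithCircuit ℂ (Fin n × Fin n) Unit G),
        C.IsSymmetric (Equiv.Perm (Fin n)) ∧ C.eval (C.output ()) = f n ∧
          C.orbitSize (Equiv.Perm (Fin n)) ≤ M := by
      intro n
      obtain ⟨G, inst, C, hC, hev, -⟩ :=
        OrbitCircuit.exists_symmetric_circuit_of_invariant (f n) (hinv n)
      exact ⟨C.orbitSize (Equiv.Perm (Fin n)), G, inst, C, hC, hev, le_rfl⟩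
    choose M hM using hsmall
    set c' : ℕ := max (c + 4) ((Finset.range (max n₀ 2)).sup M) with hc'
    refine ⟨c', fun n => ?_⟩
    rcases Nat.lt_or_ge n (max n₀ 2) with hn | hn
    · obtain ⟨G, inst, C, hC, hev, horb⟩ := hM n
      refine ⟨G, inst, C, hC, hev, horb.trans ?_⟩
      have h1 : M n ≤ c' := (Finset.le_sup (f := M) (Finset.mem_range.2 hn)).trans (le_max_right _ _)
      calc M n ≤ c' := h1
        _ ≤ (Nat.log 2 n + c') ^ c' := by
            have h0 : 0 < c' := lt_of_lt_of_le (by omega) (le_max_left _ _)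
            exact (Nat.le_add_left c' _).trans (Nat.le_self_pow h0.ne' _)
        _ ≤ 2 ^ ((Nat.log 2 n + c') ^ c') := Nat.lt_two_pow_self.le
    · obtain ⟨k, e, hk, hclose⟩ := hc n (le_trans (le_max_left _ _) hn)
      obtain ⟨G, inst, C, hC, hev, horb⟩ := NarrowToOrbit.exists_symmetric_orbit_le_of_diClose n e
      refine ⟨G, inst, C, hC, hev.trans hclose, horb.trans ?_⟩
      have h2 : 2 ≤ n := le_trans (le_max_right _ _) hn
      exact (NarrowToOrbit.orbit_arith h2 hk).trans (OrbitCompressionForms.qp_mono (le_max_left _ _))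

end OrbitSupport

end Summit.ValiantsHypothesis.ValiantsHypothesis.Theorems

end
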